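import Summits.AnomalousDissipation.AnomalousDissipation.Theorems.BaireTransferDenseLoudDesignerForcesErgodicModelCoreDynamics
import Summits.AnomalousDissipation.AnomalousDissipation.Theorems.BaireTransferDenseLoudDesignerForcesErgodicModelSemigroup
import Summits.AnomalousDissipation.AnomalousDissipation.Theorems.BaireTransferDenseLoudDesignerForcesErgodicModelCoreV
import Literature.Analysis.UnboundedOperators.SemilinearMildTubeCover
import Literature.Analysis.FluidPDE.StokesTorusResolvent

/-!
# The tube of the model map around the invariant core (registered tools stub S6a `stub_modelTubeTools` of block N,
# line `ergodic-budget-selection-closing`, crux `BaireTransfer.DenseLoudDesignerForces`, stmt-AnomalousDissipation-1143)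

Summit-side assembly over the ACCEPTED definitions `ModelFrame`, `ModelFrame.IsMild`, `ModelFrame.modelMap`
(`…ErgodicModelDefs.lean`) of the Navier–Stokes instantiation of the landed abstract mild-flow theorems
(`Literature/Analysis/UnboundedOperators/SemilinearMildTube*.lean`, `…SemilinearMildGluing.lean`,
`…SemilinearMildTubeCover.lean`) and the S6b bookkeeping of `IsMild` / `modelMap` (`…ErgodicModelSemigroup.lean`).  For an NS phase `(K, φ)` of the designer force at viscosity `ν > 0`, a model frame
`F` with frame forcing `xF` (`F.S xF = [force]`) and a compact `φ`-invariant core `Kc ⊆ K`: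

* (imported from S6b `…ErgodicModelSemigroup.lean`: the rescaled families `t ↦ F.T (νt)`, `t ↦ F.K (νt)` satisfy the
  hypotheses of the abstract theorems, and `ModelFrame.modelMap_eq_of_isMild` — the model map at `(t, y)` is the value of
  ANY admissible mild solution from `y` on `[0, t]`, by definition + uniqueness);
* `isCompact_frame_preimage_core` — the frame core `Λ = F.S ⁻¹' Kc` is COMPACT: `F.S ∘ F.S` is the resolvent
  `(1 + A)⁻¹` of the Stokes operator (`exists_resolvent_diagonalPMap` on the frame's mode basis, equality of
  coefficients), so the landed N0h `stub_modelCoreCompactVTools` applies with `τ = 1` (`Kc = φ₁(Kc) ⊆ φ₁(K)`);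
* `exists_frameCurve_of_mem_core` — the REFERENCE CURVE of `y ∈ Λ`: the frame curve `Y t = F.S([u t] − [Δu t])` of the
  classical trajectory `u` of `F.S y` starts at `y` (`F.S` injective), is continuous (`continuousOn_frameCurve`), reads
  `F.S (Y t) = [u t] = φ_t (F.S y) ∈ Kc` (S6₁ `stub_framePreimageTools`, S6d₁ `eq_stateOf_of_rep_ae_eq`, invariance), and solves the mild identity on
  every `[0, L]` (S5b `stub_conjugatedMildIdentityTools`);
* `stub_modelTubeTools` — THE TUBE: the smooth mild flow `G` on an open `U ⊇ Λ` inside `U' = ball 0 (B + 2)`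
  (`exists_open_mildFlow_of_isCompact`: finitely many tubes of S4c around the reference curves on `[0, 3]`,
  patched by uniqueness) consists of genuine mild solutions staying in `U'`, hence IS the model map on `[0, 3] × U`
  (`modelMap_eq_of_isMild`), which is therefore jointly continuous and `C^∞` in the state; and on the core the model
  map at every `t ≥ 0` is the reference curve, conjugated by `F.S` to `φ_t`.

References: D. Henry, *Geometric Theory of Semilinear Parabolic Equations*, LNM 840 (1981), Thm. 3.3.3, 3.3.4, 3.4.1,
3.4.4; P. Constantin, C. Foias, *Navier–Stokes Equations* (1988), Ch. 4 (4.11)–(4.13).  Nothing is asserted; no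
definition is added.
-/

-- `Summit.<Summit>.<Problem>` is the tree's mandated summit-side namespace (CONVENTIONS §2); for this
-- single-conjunct summit the two coincide, so the duplicate is deliberate.
set_option linter.dupNamespace false

noncomputable section

open Set Function MeasureTheory Filter
open scoped ContDiff InnerProductSpace RealInnerProductSpace Topology

namespace Summit.AnomalousDissipation.AnomalousDissipation.Theorems.DenseLoudDesignerForces.Ergodic

open Literature.Analysis.FunctionSpaces Literature.Analysis.FunctionSpaces.Torus
open Literature.Analysis.FluidPDE Literature.Analysis.FluidPDE.Torus
open Summit.AnomalousDissipation.AnomalousDissipation.Theses.BaireTransfer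
open Summit.AnomalousDissipation.AnomalousDissipation.Theorems.DenseLoudDesignerForces.Negative
open Literature.Analysis.UnboundedOperators

/-! ## Compactness of the frame core -/

/-- **The frame core `Λ = F.S ⁻¹' Kc` of a compact invariant core is compact.**  On the frame's mode basis the resolvent
`R = (1 + A)⁻¹` exists (`exists_resolvent_diagonalPMap`, `A = b.diagonalPMap m = stokesOperatorH`), and `F.S ∘ F.S = R`
(coefficients `(1 + m_i)^{-1/2} (1 + m_i)^{-1/2} = (1 + m_i)⁻¹`); since `Kc = φ₁(Kc) ⊆ φ₁(K)`, the landed compactness of the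
V-frame core `stub_modelCoreCompactVTools` (parabolic smoothing + Rellich) applies with `τ = 1`. [folklore] -/
theorem isCompact_frame_preimage_core {ν : ℝ} {Ff : (UnitAddTorus (Fin 3)) → (EuclideanSpace ℝ (Fin 3))} {K : Set Hsp}
    {φ : ℝ → Hsp → Hsp} (hν : 0 < ν) (hK : IsNSPhase ν Ff K φ) (F : ModelFrame) {Kc : Set Hsp} (hKcK : Kc ⊆ K)
    (hKc : IsCompact Kc) (hinv : ∀ t : ℝ, 0 ≤ t → φ t '' Kc = Kc) : IsCompact (F.S ⁻¹' Kc) := by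
  -- the resolvent on the frame's basis and its coefficients
  obtain ⟨R, -, -, -, -, hR, hR'⟩ := exists_resolvent_diagonalPMap F.b (fun i => (F.hpos i).le) F.htend
  have h1 : ∀ i, 0 < 1 + F.m i := fun i => by linarith [F.hpos i]
  have hRc : ∀ (v : Hsp) (i : F.ι), F.b.repr (R v) i = (1 + F.m i)⁻¹ * F.b.repr v i := fun v i => by
    obtain ⟨hv, hRv⟩ := hR v
    have h := congrArg (fun z => F.b.repr z i) hRv
    simp only [map_add, lp.coeFn_add, Pi.add_apply, HilbertBasis.repr_diagonalPMap_apply] at h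
    rw [eq_inv_mul_iff_mul_eq₀ (h1 i).ne']
    linear_combination h
  -- `F.S ∘ F.S = R`
  have hSS : F.S.comp F.S = R := by
    refine ContinuousLinearMap.ext fun v => F.b.repr.injective (lp.ext (funext fun i => ?_))
    rw [ContinuousLinearMap.comp_apply, repr_apply_of_apply_basis F.b _ F.S F.hS,
      repr_apply_of_apply_basis F.b _ F.S F.hS, hRc]
    dsimp only
    rw [← mul_assoc, ← Real.rpow_add (h1 i), show -(1 / 2 : ℝ) + -(1 / 2 : ℝ) = -1 by norm_num, Real.rpow_neg_one]
  -- transport the resolvent identities to the Stokes operator and apply N0h with `τ = 1`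
  have hA := F.hA
  have hR₁ : ∀ v : Hsp, ∃ hv : R v ∈ (stokesOperatorH (Fin 3)).domain, R v + stokesOperatorH (Fin 3) ⟨R v, hv⟩ = v := by
    rw [hA]
    exact hR
  have hR₂ : ∀ (v : Hsp) (hv : v ∈ (stokesOperatorH (Fin 3)).domain), R (v + stokesOperatorH (Fin 3) ⟨v, hv⟩) = v := by
    rw [hA]
    exact hR'
  have hsub : Kc ⊆ φ 1 '' K := fun v hv => by
    have h : v ∈ φ 1 '' Kc := by
      rw [hinv 1 zero_le_one]
      exact hv
    exact image_mono hKcK h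
  exact (stub_modelCoreCompactVTools hν hK F.S R hSS F.hSinj hR₁ hR₂ hKc one_pos hsub).1

/-! ## Reference frame curves of core states -/

/-- **The reference curve of a point of the frame core.**  For `y` with `F.S y ∈ Kc`, let `(u, p)` be the classical trajectory
of the state `F.S y ∈ K` and `Y t := F.S ([u t] − [Δ u t])` its frame curve.  Then `Y 0 = y` (`F.S` injective), `Y` is continuous
on every `[0, L]` (`continuousOn_frameCurve`), `F.S (Y t) = [u t] = φ_t (F.S y) ∈ Kc` for `t ≥ 0` (S6₁, `rep (φ_t x) = u t` a.e.,
invariance of `Kc`), and `Y` solves the frame-conjugated mild identity from `y` on `[0, ∞)` (S5b with `a₀ = 0`). [folklore] -/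
theorem exists_frameCurve_of_mem_core {S : Finset (Fin 3 → ℤ)} {c : ↥S → (EuclideanSpace ℂ (Fin 3))} {ν : ℝ} {K : Set Hsp}
    {φ : ℝ → Hsp → Hsp} (hν : 0 < ν) (hK : IsNSPhase ν (force S c) K φ) (F : ModelFrame) (xF : Hsp)
    (hxF : F.S xF = stateOf (force S c)) {Kc : Set Hsp} (hKcK : Kc ⊆ K) (hinv : ∀ t : ℝ, 0 ≤ t → φ t '' Kc = Kc)
    {y : Hsp} (hy : F.S y ∈ Kc) :
    ∃ Y : ℝ → Hsp, Y 0 = y ∧ (∀ L : ℝ, ContinuousOn Y (Icc 0 L)) ∧ (∀ t : ℝ, 0 ≤ t → F.S (Y t) = φ t (F.S y)) ∧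
      (∀ t : ℝ, 0 ≤ t → F.S (Y t) ∈ Kc) ∧
      ∀ r : ℝ, 0 ≤ r → Y r = F.T (ν * r) y + (∫ s in (0 : ℝ)..r, F.T (ν * (r - s)) xF) -
        ∫ s in (0 : ℝ)..r, F.K (ν * (r - s)) (F.Nb (Y s) (Y s)) := by
  obtain ⟨hFs, hFd, hFm⟩ := stub_designerForceTools S c
  have hx : F.S y ∈ K := hKcK hy
  obtain ⟨u, p, hsol, hrep⟩ := hK.trajectory (F.S y) hx
  have hus : ∀ t : ℝ, 0 ≤ t → IsSmooth (u t) := fun t ht => hsol.smooth_velocity.isSmooth_slice (mem_Ici.2 ht)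
  have hud : ∀ t : ℝ, 0 ≤ t → IsDivFree (u t) := fun t ht => hsol.divFree t (mem_Ici.2 ht)
  have hum : ∀ t : ℝ, 0 ≤ t → HasZeroMean (u t) := fun t ht => hasZeroMean_of_rep_ae_eq (φ t (F.S y)) (hrep t ht)
  have hst : ∀ t : ℝ, 0 ≤ t → stateOf (u t) = φ t (F.S y) := fun t ht =>
    (eq_stateOf_of_rep_ae_eq _ (hus t ht) (hud t ht) (hrep t ht)).symm
  -- the frame curve and its frame image
  obtain ⟨Y, hYdef⟩ : ∃ Y : ℝ → Hsp, Y = fun t => F.S (stateOf (u t) - stateOf (laplacian (u t))) := ⟨_, rfl⟩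
  have hSY : ∀ t : ℝ, 0 ≤ t → F.S (Y t) = stateOf (u t) := fun t ht => by
    rw [hYdef]
    exact stub_framePreimageTools F.ι F.b F.m F.hmodes F.S F.hS (hus t ht) (hud t ht) (hum t ht)
  have hY0 : Y 0 = y := F.hSinj (by rw [hSY 0 le_rfl, hst 0 le_rfl, hK.map_zero _ hx])
  -- the classical trajectory on the windows `[0, 0 + τ']`
  have hwin : ∀ τ' : ℝ, 0 < τ' → IsClassicalNSSolutionOn (Icc 0 (0 + τ')) ν (fun _ => force S c) u p ∧
      (∀ t ∈ Icc (0 : ℝ) (0 + τ'), HasZeroMean (u t)) ∧ ∀ t ∈ Icc (0 : ℝ) τ', F.S (Y t) = stateOf (u (0 + t)) :=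
    fun τ' hτ' => ⟨hsol.mono Icc_subset_Ici_self (uniqueDiffOn_Icc (by linarith)), fun t ht => hum t ht.1,
      fun t ht => by rw [zero_add]; exact hSY t ht.1⟩
  refine ⟨Y, hY0, fun L => ?_, fun t ht => (hSY t ht).trans (hst t ht), fun t ht => ?_, fun r hr => ?_⟩
  · -- continuity on `[0, L] ⊆ [0, max L 1]`
    have hL : 0 < max L 1 := lt_max_of_lt_right one_pos
    obtain ⟨hsol', hmean', hy'⟩ := hwin (max L 1) hL
    exact (continuousOn_frameCurve F.b F.hmodes F.hS hL hsol' hmean' hy').mono (Icc_subset_Icc_right (le_max_left _ _))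
  · -- invariance of the core
    rw [(hSY t ht).trans (hst t ht), ← hinv t ht]
    exact mem_image_of_mem _ hy
  · -- the mild identity on `[0, r + 1]` (S5b)
    have hr1 : 0 < r + 1 := by linarith
    obtain ⟨hsol', hmean', hy'⟩ := hwin (r + 1) hr1
    have h := stub_conjugatedMildIdentityTools F.ι F.b F.m F.hpos F.hmodes F.S F.hS F.T F.K F.hT F.hTnorm F.hTsa F.hTc
      F.hK F.hKnorm F.hKc F.Nb F.hNb hν hFs hFd hFm hr1 hsol' hmean' Y hy' xF hxF r ⟨hr, by linarith⟩
    rwa [hY0] at h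

/-! ## The registered tools stub -/

/-- **Tools stub S6a of block N — THE TUBE OF THE MODEL MAP around the invariant core.**  For an NS phase `(K, φ)` of the
designer force at `ν > 0`, a model frame `F` with frame forcing `xF` and a compact invariant core `Kc ⊆ K` (`φ_t(Kc) = Kc`):
there are an open `U ⊇ F.S ⁻¹' Kc` and a bounded open `U' ⊇ U` such that from every `y ∈ U` and for every `t ∈ [0, 3]` a mild
solution of the frame-conjugated equation staying in `U'` exists on `[0, t]` and gives the model map `g = F.modelMap ν xF U'`;
`g` is jointly continuous on `[0, 3] × U` and `C^∞` in the state at each time; and on the core `F.S (g t y) = φ_t (F.S y)` for all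
`t ≥ 0`.  Proof: `Λ = F.S ⁻¹' Kc` is compact (`isCompact_frame_preimage_core`); the reference curves of its points
(`exists_frameCurve_of_mem_core`) are mild solutions on `[0, 3]` staying in `Λ`; the abstract smooth mild flow near a compact set of
data (`exists_open_mildFlow_of_isCompact` = finitely many tubes of S4c `exists_mildTube` patched by uniqueness) gives `U`, `U'`, `G`;
`g = G` on `[0, 3] × U` and `g t y =` the reference curve on the core, by the uniqueness of admissible mild solutions
(`modelMap_eq_of_isMild`). [folklore] -/
theorem stub_modelTubeTools {S : Finset (Fin 3 → ℤ)} {c : ↥S → (EuclideanSpace ℂ (Fin 3))} {ν : ℝ} {K : Set Hsp} {φ : ℝ → Hsp → Hsp}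
    (hν : 0 < ν) (hK : IsNSPhase ν (force S c) K φ) (F : ModelFrame) (xF : Hsp) (hxF : F.S xF = stateOf (force S c))
    {Kc : Set Hsp} (hKcK : Kc ⊆ K) (hKc : IsCompact Kc) (hinv : ∀ t : ℝ, 0 ≤ t → φ t '' Kc = Kc) :
    ∃ U U' : Set Hsp, IsOpen U ∧ IsOpen U' ∧ Bornology.IsBounded U' ∧ F.S ⁻¹' Kc ⊆ U ∧ U ⊆ U' ∧
      (∀ y ∈ U, ∀ t ∈ Icc (0 : ℝ) 3, ∃ (ht : 0 ≤ t) (z : C(Icc (0 : ℝ) t, Hsp)),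
        F.IsMild ν xF ht y z ∧ (∀ r, z r ∈ U') ∧ F.modelMap ν xF U' t y = z ⟨t, ht, le_rfl⟩) ∧
      ContinuousOn (fun q : ℝ × Hsp => F.modelMap ν xF U' q.1 q.2) (Icc (0 : ℝ) 3 ×ˢ U) ∧
      (∀ t ∈ Icc (0 : ℝ) 3, ContDiffOn ℝ ∞ (fun y => F.modelMap ν xF U' t y) U) ∧
      (∀ t : ℝ, 0 ≤ t → ∀ y : Hsp, F.S y ∈ Kc → F.S (F.modelMap ν xF U' t y) = φ t (F.S y)) := by
  have h03 : (0 : ℝ) ≤ 3 := by norm_num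
  have h3 : (0 : ℝ) < 3 := by norm_num
  have hα : (3 / 4 : ℝ) < 1 := by norm_num
  have hC : 0 ≤ ν ^ (-(3 / 4 : ℝ)) := Real.rpow_nonneg hν.le _
  -- the compact frame core and a bound for it
  have hΛc : IsCompact (F.S ⁻¹' Kc) := isCompact_frame_preimage_core hν hK F hKcK hKc hinv
  obtain ⟨B, hB⟩ := hΛc.isBounded.exists_norm_le
  -- reference curves of the core points
  have href := fun (y : Hsp) (hy : F.S y ∈ Kc) => exists_frameCurve_of_mem_core hν hK F xF hxF hKcK hinv hy
  choose! Yr hY0 hYc hYφ hYKc hYm using href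
  -- the smooth mild flow `G` on an open `U ⊇ Λ` inside `U' = ball 0 (B + 2)`
  obtain ⟨U, hUo, hΛU, hUU', G, hGc, hGd, hG⟩ := exists_open_mildFlow_of_isCompact (fun t => F.T (ν * t))
    (fun t => F.K (ν * t)) (F.T_mul_zero ν) (F.T_mul_add hν.le) (F.norm_T_mul_le hν.le) (F.continuous_T_mul ν) hα hC
    (F.norm_K_mul_le hν) (F.K_mul_add hν) (F.continuousOn_K_mul hν) F.Nb xF h3 hΛc (B := B)
    fun y hy => ⟨Yr y, hYc y hy 3, fun t ht => hB _ (hYKc y hy t ht.1), fun t ht => hYm y hy t ht.1⟩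
  -- on `[0, 3] × U` the model map is `G`: genuine admissible mild solutions
  have key : ∀ y ∈ U, ∀ (t : ℝ) (ht : t ∈ Icc (0 : ℝ) 3), ∃ z : C(Icc (0 : ℝ) t, Hsp), F.IsMild ν xF ht.1 y z ∧
      (∀ r, z r ∈ Metric.ball (0 : Hsp) (B + 2)) ∧ F.modelMap ν xF (Metric.ball 0 (B + 2)) t y = z ⟨t, ht.1, le_rfl⟩ ∧
      z ⟨t, ht.1, le_rfl⟩ = G y ⟨t, ht⟩ := by
    intro y hy t ht
    have hGy : F.IsMild ν xF h03 y (G y) := (hG y hy).1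
    obtain ⟨z, hz, hzG⟩ := hGy.restrict ht.1 ht.2
    have hzU : ∀ r, z r ∈ Metric.ball (0 : Hsp) (B + 2) := fun r => by
      rw [hzG r, mem_ball_zero_iff]
      linarith [(hG y hy).2 ⟨r, r.2.1, r.2.2.trans ht.2⟩]
    exact ⟨z, hz, hzU, F.modelMap_eq_of_isMild hν ht.1 hz hzU, hzG _⟩
  have hmG : ∀ y ∈ U, ∀ (t : ℝ) (ht : t ∈ Icc (0 : ℝ) 3), F.modelMap ν xF (Metric.ball 0 (B + 2)) t y = G y ⟨t, ht⟩ :=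
    fun y hy t ht => by
      obtain ⟨z, -, -, hm, hzG⟩ := key y hy t ht
      exact hm.trans hzG
  refine ⟨U, Metric.ball 0 (B + 2), hUo, Metric.isOpen_ball, Metric.isBounded_ball, hΛU, hUU', fun y hy t ht => ?_, ?_,
    fun t ht => (hGd ⟨t, ht⟩).congr fun y hy => hmG y hy t ht, fun t ht y hy => ?_⟩
  · -- genuine admissible mild solutions give the model map
    obtain ⟨z, hz, hzU, hm, -⟩ := key y hy t ht
    exact ⟨ht.1, z, hz, hzU, hm⟩
  · -- joint continuity on `[0, 3] × U`
    have hc : ContinuousOn (fun q : ℝ × Hsp => G q.2 (projIcc 0 3 h03 q.1)) (Icc (0 : ℝ) 3 ×ˢ U) :=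
      (hGc.comp continuousOn_snd fun q hq => hq.2).eval (continuous_projIcc.comp continuous_fst).continuousOn
    refine hc.congr fun q hq => ?_
    dsimp only
    rw [hmG q.2 hq.2 q.1 hq.1, projIcc_of_mem h03 hq.1]
  · -- conjugacy on the core for every `t ≥ 0`: the model map is the reference curve
    obtain ⟨z, hz, hzY⟩ := exists_mild_of_eqOn (fun t => F.T (ν * t)) (fun t => F.K (ν * t)) F.Nb xF (hYc y hy t)
      (fun r hr => hYm y hy r hr.1) ht le_rfl
    have hz' : F.IsMild ν xF ht y z := hz
    have hzU : ∀ r, z r ∈ Metric.ball (0 : Hsp) (B + 2) := fun r =>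
      hUU' (hΛU (by rw [mem_preimage, hzY r]; exact hYKc y hy r r.2.1))
    rw [F.modelMap_eq_of_isMild hν ht hz' hzU, hzY]
    exact hYφ y hy t ht

end Summit.AnomalousDissipation.AnomalousDissipation.Theorems.DenseLoudDesignerForces.Ergodic

end
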